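import Mathlib.GroupTheory.PGroup
import Literature.RepresentationTheory.FiniteGroups.CharacterCentre
import Literature.RepresentationTheory.FiniteGroups.CharacterDegreeDvdCard
import HarnessLib

/-!
# For a `p`-group, `χ(1)²` divides `|G : Z(χ)|` (Isaacs, *Character Theory of Finite Groups*,
# Problem 3.6)

Topic `Literature/RepresentationTheory/FiniteGroups`, namespace
`Literature.RepresentationTheory.FiniteGroups` (lane `lit-hodgefound`, prover p38, row g14-#11;
uses `CharacterCentre` (Def. 2.26 `Z(χ) = Representation.centre`, Cor. 2.28 `Z(G) ⊆ Z(χ)`,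
Cor. 2.30 `χ(1)² ≤ |G : Z(χ)|`) and `CharacterDegreeDvdCard` (degrees of `p`-groups are powers
of `p`)).  Everything here is **proved**; no definition, no named fact.

Source, verbatim.  I. M. Isaacs, *Character Theory of Finite Groups*, Academic Press 1976 (held
`book:isaacsnd-character-theory-finite-groups`, p. 50 = p0048 L25; Problems to Chapter 3):

> "(3.6) Let `G` be a `p`-group and suppose `χ ∈ Irr(G)`. Show that `χ(1)² | |G : Z(χ)|`."

Solution formalised: `χ(1) = p^j` (James–Liebeck 22.12(1), the tree's
`exists_eq_prime_pow_of_mem_charDegrees`) and `|G : Z(χ)| = p^b` (a divisor of `|G| = p^k`), while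
`χ(1)² ≤ |G : Z(χ)|` (Cor. 2.30, `Representation.finrank_sq_le_index_centre`); so `p^{2j} ≤ p^b`,
`2j ≤ b`, and `p^{2j} ∣ p^b`.  Results: **`Representation.finrank_sq_dvd_index_centre_of_isPGroup`**
(for an irreducible `ρ` affording `χ`: `(dim V)² ∣ |G : Z(χ)|`), the character-level
`IsIrrChar.exists_apply_one_sq_dvd_index_centre`, and with `Z(G) ⊆ Z(χ)`:
`sq_dvd_index_center_of_mem_charDegrees_of_isPGroup` (`d² ∣ |G : Z(G)|` for `d ∈ cd(G)`).

## Mathlib / tree search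

Mathlib: `IsPGroup`, `IsPGroup.exists_card_eq`, `Nat.dvd_prime_pow`, `Nat.pow_le_pow_iff_right`,
`pow_dvd_pow`, `Subgroup.index_dvd_card`, `Subgroup.index_dvd_of_le`; no `Z(χ)` in Mathlib.  Tree,
consumed by name: `Representation.centre`, `Representation.finrank_sq_le_index_centre`,
`Representation.center_le_centre` (`CharacterCentre`), `exists_eq_prime_pow_of_mem_charDegrees`
(`CharacterDegreeDvdCard`), `charDegrees` (`CharacterDegrees`), `Representation.char_one` (Mathlib);
FAIL-DUP: the tree has Thm. 2.31 / Cor. 2.30 (`index_centre_eq_finrank_sq_of_commutator_le`,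
`finrank_sq_le_index_centre`) and Thm. 3.12 (`CharacterDegreeDvdIndexCentre`:
`χ(1) ∣ |G : Z(χ)|`), not the square divisibility for `p`-groups.

## References

* I. M. Isaacs, *Character Theory of Finite Groups*, Academic Press 1976, Problem 3.6 (with
  Cor. 2.28, Cor. 2.30) (`Isaacs1976`).
-/

noncomputable section

open Module

namespace Literature.RepresentationTheory.FiniteGroups

variable {G : Type} [Group G] [Fintype G] {V : Type} [AddCommGroup V] [Module ℂ V]
  [FiniteDimensional ℂ V]

/-- **Isaacs, Problem 3.6: "Let `G` be a `p`-group and suppose `χ ∈ Irr(G)`. Show that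
`χ(1)² | |G : Z(χ)|`."**  Both `χ(1)` and `|G : Z(χ)|` are powers of `p`, and `χ(1)² ≤ |G : Z(χ)|`
(Cor. 2.30), so the inequality of exponents is a divisibility.  Here `χ` is afforded by `𝔛 = ρ`,
`χ(1) = dim V` and `Z(χ) = Representation.centre ρ`. [cite: Isaacs1976, Problem 3.6] -/
theorem Representation.finrank_sq_dvd_index_centre_of_isPGroup {p : ℕ} [hp : Fact p.Prime]
    (hG : IsPGroup p G) (ρ : Representation ℂ G V) [hρ : ρ.IsIrreducible] :
    finrank ℂ V ^ 2 ∣ (Representation.centre ρ).index := by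
  obtain ⟨k, hk⟩ := hG.exists_card_eq
  -- `χ(1) = p^j`
  have hd : finrank ℂ V ∈ charDegrees G := ⟨V, _, _, ‹_›, ρ, hρ, rfl⟩
  obtain ⟨j, -, hj⟩ := exists_eq_prime_pow_of_mem_charDegrees hp.out hk hd
  -- `|G : Z(χ)| = p^b`
  obtain ⟨b, -, hb⟩ := (Nat.dvd_prime_pow hp.out).mp
    (hk ▸ (Representation.centre ρ).index_dvd_card)
  have hle := Representation.finrank_sq_le_index_centre ρ
  rw [hj, hb, ← pow_mul] at hle ⊢
  exact pow_dvd_pow p ((Nat.pow_le_pow_iff_right hp.out.one_lt).mp hle)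

/-- Problem 3.6 for irreducible characters: for a `p`-group `G` and `χ ∈ Irr(G)` afforded by `ρ`,
`χ(1) = d` with `d² ∣ |G : Z(χ)|`. [cite: Isaacs1976, Problem 3.6] -/
theorem IsIrrChar.exists_apply_one_sq_dvd_index_centre {p : ℕ} [Fact p.Prime] (hG : IsPGroup p G)
    {χ : G → ℂ} (hχ : IsIrrChar G χ) :
    ∃ (W : Type) (_ : AddCommGroup W) (_ : Module ℂ W) (_ : FiniteDimensional ℂ W)
      (σ : Representation ℂ G W) (d : ℕ), σ.character = χ ∧ χ 1 = d ∧
        d ^ 2 ∣ (Representation.centre σ).index := by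
  obtain ⟨W, _, _, _, σ, hσ, rfl⟩ := hχ
  haveI := hσ
  exact ⟨W, _, _, ‹_›, σ, finrank ℂ W, rfl, σ.char_one,
    Representation.finrank_sq_dvd_index_centre_of_isPGroup hG σ⟩

/-- Problem 3.6 with `Z(G) ⊆ Z(χ)` (Cor. 2.28): for a `p`-group, `d² ∣ |G : Z(G)|` for every
character degree `d`. [cite: Isaacs1976, Problem 3.6] -/
theorem sq_dvd_index_center_of_mem_charDegrees_of_isPGroup {p : ℕ} [Fact p.Prime]
    (hG : IsPGroup p G) {d : ℕ} (hd : d ∈ charDegrees G) : d ^ 2 ∣ (Subgroup.center G).index := by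
  obtain ⟨W, _, _, _, σ, hσ, rfl⟩ := hd
  haveI := hσ
  exact (Representation.finrank_sq_dvd_index_centre_of_isPGroup hG σ).trans
    (Subgroup.index_dvd_of_le (Representation.center_le_centre σ))

end Literature.RepresentationTheory.FiniteGroups

end
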